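import Summits.QuantumFields.BalabanUV.Beta.EriceRemainderEnclosureHistoryAutonomyComparisonAgeCompositionNestedYoungPair

/-!
# EriceRemainderEnclosureHistoryAutonomyComparisonAgeCompositionNestedOldPair — (E92f) route (N), first order: THE NESTED STEP WITH THE OLD-PAIR SHARE
# BOUND — THE NEAR REGIME OF THE CENSUS THREE AGES.  (E92d) keeps the young pair's bound `x₁ + x₂ ≤ σ₁₂` through the nested steps and closes every old
# TAIL; the complementary regime — the old age not far above the middle one — is served by the OLD pair's bound `x₂ + x₃ ≤ σ₂₃ = √2∕(1+p₀)`,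
# `p₀⁴(k₃+1) ≤ k₂+1` ((E92b) `pair_load_le_of_ratio`): with the young load at its cap `√2∕2`, the nested residual is `h(x₂, x₃)·e`,
# `h = (1−s)[(1−x₂)(1−x₃) − 2(k₂+1)x₂x₃∕k₃] − 2√2·(x₂∕k₂ + x₃∕k₃)` (`s = √2∕2`) — BILINEAR, decreasing in `x₃`, cross coefficient `≥ 0` for
# `k₃ ≥ 2(k₂+1)` — so (E92d) `pentagon_bilinear_nonneg` on `{x₂, x₃ ≤ s, x₂ + x₃ ≤ σ₂₃}` reduces the END to ONE displayed inequality
# `2∕k₂ + (σ₂₃ − s)·(2√2 + (√2−1)(k₂+1))∕k₃ ≤ (1−s)²·(1 + s − σ₂₃)`.  It holds from `k₂ ≈ 45` for every `k₃` between `2(k₂+1)` and the tails of (E92e)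
# (README g83∕e92 §3); the rational bands and the union «every old age from `k₂ ≥ 50`» are (E92g)

Cell `pub-balaban`, β-function sub-cell, BINDER row D4 «RemainderConst leaves for Bałaban's split» (`HOME/BINDER-OWNERS.md`; owner lineage `b2b-balaban-beta-an4`;
this file by co-owner #2 lineage `b2b-balaban-beta-d4-p2`, generation 83), β-FLOW TEAM duty (1), FREEZE (0) honoured (def-free; nothing restated).

HONEST FRAMING (page 1, verbatim and binding).  *"Discharging BetaPertH makes Bałaban's UV stability UNCONDITIONAL — a real constructive-QFT result; it is
NOT the continuum limit and NOT the Clay problem."*  THIS FILE DISCHARGES NOTHING OF THE KIND.  Elementary real algebra ∕ real analysis about ABSTRACT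
functionals on a box ]0,γ]^ℕ with displayed floors, profiles and signs, and the FIRST-ORDER renewal objects of route (N) built from them — hypotheses of a
census, not facts; the form, signs, ages and moments of Bałaban's (1.22) limit functional are NOT PRINTED ([I] p. 298; GAPS G-t4-U2-1∕-2) and NOT asserted.
Row D4 class UNCHANGED (critical-path width 0; instance 0∕1; D4 DISCHARGE NO DATE).  HONEST DEPENDENCY: continuum YM on T⁴ ⇐ BetaPertH ∧ nine spine
estimates (0/9 proved); BetaPertH ⇐ (D1) ∧ (D4) ∧ CAP+tail; G-an2-4 gates asym, D1 and NE2/3/4.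

THE POINT (README `HOME/b2b-balaban-beta-d4-p2/g83/e92/README.md` §2(e)).  Middle step ((E92c) `residual_step_moment`, `sy = x₂`, first moment
`c₂k₂(k₂+1)∕2`, old variation `4c₃` per lag): `e − O − M ≥ R₂·e`, `R₂ = (1−x₂)(1−x₃) − 2(k₂+1)x₂x₃∕k₃` with the ACTUAL old load `x₃ = k₃c₃`; young step
(`sy = s ≥ x₁`, first moment `c₁ ≤ s`, variation `4(c₂+c₃)` per lag): `ε ≥ [(1−s)R₂ − 4s(c₂+c₃)]·e = h(x₂,x₃)·e`; `h ≥ 0` at `(x₂,x₃)` by (E92d)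
`pentagon_bilinear_nonneg` with `G₀ = 1−s`, `G₁ = (1−s) + 2√2∕k₂`, `G₂ = (1−s) + 2√2∕k₃`, `G₁₂ = (1−s)(1 − 2(k₂+1)∕k₃)`: `g(0,s) = (1−s)² − 2∕k₃`,
`g(s,σ−s)` is the displayed inequality and `g(σ−s,s) − g(s,σ−s) = 2√2(1∕k₂ − 1∕k₃)(2s − σ) ≥ 0`; and `h ≥ 0` gives `R₂ ≥ 0` (the middle residual the
young step needs).  Uses (E92d) `pentagon_bilinear_nonneg`, (E92c) `residual_step_moment`∕`row_moment_le`, (E92b) `pair_load_le_of_ratio`, (E92a)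
`renewal_bounds_of_step`, (E91a) `old_read_variation`, (E82a) `kernel_entry_le`∕`row_mass_le`, (E89b) `window_load_le_sqrt_two_div_two`, (E80b)
`aggregate_eq_sum` BY NAME.  NOT CLAIMED: `k₃ < 2(k₂+1)` (R1 of (E92b)); `k₂ ≲ 44` (the `2∕k₂` of the young step); anything printed — NOT B12 Thm 2,
NOT BetaPertH.

WHAT IS PROVED ([folklore]; 0 `def`, 0 sorry).  §1 **`flow_nonneg_census_three_ages_old_pair`** (parametric `p₀`, one displayed inequality).
§2 `old_pair_slack_le`, `old_pair_check` (the displayed inequality from rational data on a ratio band `r_lo(k₂+1) ≤ k₃`).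
-/
noncomputable section
open Finset

namespace Summit.QuantumFields.BalabanUV.Beta.EriceRemainderEnclosureHistoryAutonomyComparisonAgeCompositionNestedOldPair

open Literature.MathematicalPhysics.QuantumFieldTheory.Balaban1983to89
open Literature.MathematicalPhysics.QuantumFieldTheory.Balaban1983to89.T4BetaStationary
open Literature.MathematicalPhysics.QuantumFieldTheory.Balaban1983to89.T4BetaFlowWellPosed
open Summit.QuantumFields.BalabanUV.Beta.EriceRemainderEnclosureHistoryAutonomyComparisonAgeCompositionTwoAgesOldRead (old_read_variation)
open Summit.QuantumFields.BalabanUV.Beta.EriceRemainderEnclosureHistoryAutonomyComparisonAgeCompositionThreeAgesMassCap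
  (window_load_le_sqrt_two_div_two)
open Summit.QuantumFields.BalabanUV.Beta.EriceRemainderEnclosureHistoryAutonomyComparisonAgeCompositionYoungestTailSumFlow
  (kernel_entry_le row_mass_le)
open Summit.QuantumFields.BalabanUV.Beta.EriceRemainderEnclosureHistoryAutonomyComparisonAgeCompositionChainWiring (aggregate_eq_sum)
open Summit.QuantumFields.BalabanUV.Beta.EriceRemainderEnclosureHistoryAutonomyComparisonAgeCompositionNestedReads (renewal_bounds_of_step)
open Summit.QuantumFields.BalabanUV.Beta.EriceRemainderEnclosureHistoryAutonomyComparisonAgeCompositionPairShares (pair_load_le_of_ratio)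
open Summit.QuantumFields.BalabanUV.Beta.EriceRemainderEnclosureHistoryAutonomyComparisonAgeCompositionNestedMoments
  (residual_step_moment row_moment_le)
open Summit.QuantumFields.BalabanUV.Beta.EriceRemainderEnclosureHistoryAutonomyComparisonAgeCompositionNestedYoungPair
  (pentagon_bilinear_nonneg)

variable {B : (ℕ → ℝ) → ℝ} {γ b gIR : ℝ} {L : ℕ → ℝ} {K : ℕ} {h g : ℕ → ℝ}

/-! ## §1 The census three ages with the old-pair share bound kept through the nested steps -/

/-- **THE CENSUS THREE AGES `{1, k₂, k₃}` WITH `k₃ ≥ 2(k₂+1)`: THE END ALONG EVERY FLOW FROM ONE DISPLAYED INEQUALITY BETWEEN THE OLD-PAIR SLACK AND THE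
MIDDLE AGE.**  Profile carried by `{1, k₂, k₃}`, `2 ≤ k₂`, `2(k₂+1) ≤ k₃ < K`; dampings of the self-consistent class `g_t(1+F_t) ≥ 1`; `p₀ ≥ 0` with
`p₀⁴(k₃+1) ≤ k₂+1` (so `x₂ + x₃ ≤ σ := √2∕(1+p₀)` by (E92b)); IF
`2∕k₂ + (σ − √2∕2)·(2√2 + (√2−1)(k₂+1))∕k₃ ≤ (1 − √2∕2)²·(1 + √2∕2 − σ)`, THEN `0 ≤ ε ≤ e` at every pin for every admissible excess and every
horizon. [folklore] -/
theorem flow_nonneg_census_three_ages_old_pair (hmono : ∀ u v : ℕ → ℝ, SeqBox γ u → SeqBox γ v → (∀ j, u j ≤ v j) → B u ≤ B v)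
    (hL : ∀ k, 0 ≤ L k) (hb : 0 < b) (hlo : ∀ u, SeqBox γ u → b ≤ B u) (hdom : ∀ u, SeqBox γ u → ∑ k ∈ range K, L k * u k ≤ B u)
    (hh : SeqBox γ h) (hf : MemFlow B gIR h) (hg : ∀ t, 0 < g t ∧ g t ≤ 1)
    (hgF : ∀ t, 1 ≤ g t * (1 + ∑ k ∈ range K, L k * h (t + k) ^ 3 / 2))
    {k₂ k₃ : ℕ} (hk2 : 2 ≤ k₂) (hk23 : 2 * (k₂ + 1) ≤ k₃) (hk3K : k₃ < K) (hL3 : ∀ j, j < K → j ≠ 1 → j ≠ k₂ → j ≠ k₃ → L j = 0)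
    {p₀ : ℝ} (hp0 : 0 ≤ p₀) (hp : p₀ ^ 4 * ((k₃ : ℝ) + 1) ≤ (k₂ : ℝ) + 1)
    (hv : 2 / (k₂ : ℝ) + (Real.sqrt 2 / (1 + p₀) - Real.sqrt 2 / 2) * (2 * Real.sqrt 2 + (Real.sqrt 2 - 1) * ((k₂ : ℝ) + 1)) / k₃
        ≤ (1 - Real.sqrt 2 / 2) ^ 2 * (1 + Real.sqrt 2 / 2 - Real.sqrt 2 / (1 + p₀)))
    {N : ℕ} {KL : ℕ → ℕ → ℕ → ℝ}
    (hKL : ∀ k n l, KL k n l = if 0 < k ∧ k < K ∧ l < k then L k * h (n + k) ^ 3 / 2 * ∏ t ∈ Ico (n + 1 + l) (n + k + 1), g t else 0)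
    {KA : ℕ → ℕ → ℕ → ℝ} {RA : ℕ → (ℕ → ℝ) → ℕ → ℝ}
    (hRA : ∀ i v m, RA i v m = ∑ l ∈ range K, KA i m l * v (m + 1 + l))
    (hKA : ∀ i m l, KA i m l = KL i m l + KA (i + 1) m l) (hKAtop : ∀ m l, KA K m l = 0)
    {e ε : ℕ → ℝ} (he0 : ∀ m, 0 ≤ e m) (hea : ∀ m, e (m + 1) ≤ e m)
    (hεt : ∀ m, N < m → ε m = 0) (hεrec : ∀ m, ε m = e m - RA 1 ε m) : ∀ m, 0 ≤ ε m ∧ ε m ≤ e m := by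
  have hpos : ∀ n, 0 < h n := fun n => (hh n).1
  have h1K : 1 < K := by omega
  have hk2K : k₂ < K := by omega
  have hj : 0 < k₂ := by omega
  have hk : 0 < k₃ := by omega
  have hK : 1 ≤ K := by omega
  have hL0 : L 0 = 0 := hL3 0 (by omega) (by omega) (by omega) (by omega)
  have hs2 : Real.sqrt 2 ^ 2 = 2 := Real.sq_sqrt (by norm_num)
  have hs0 : 0 ≤ Real.sqrt 2 := Real.sqrt_nonneg 2
  have hs17 : Real.sqrt 2 ≤ 17 / 12 := Real.sqrt_le_iff.mpr ⟨by norm_num, by norm_num⟩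
  have hs1 : (1 : ℝ) ≤ Real.sqrt 2 := by rw [Real.le_sqrt (by norm_num) (by norm_num)]; norm_num
  have hjr : (0 : ℝ) < k₂ := by exact_mod_cast hj
  have hkr : (0 : ℝ) < k₃ := by exact_mod_cast hk
  have hk2ne : (k₂ : ℝ) ≠ 0 := hjr.ne'
  have hk3ne : (k₃ : ℝ) ≠ 0 := hkr.ne'
  have hk23r : 2 * ((k₂ : ℝ) + 1) ≤ k₃ := by exact_mod_cast hk23
  have h1p : 0 < 1 + p₀ := by linarith
  have hea' : ∀ p q, p ≤ q → e q ≤ e p := by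
    intro p q hpq
    induction q, hpq using Nat.le_induction with
    | base => exact le_rfl
    | succ q _ ih => exact (hea q).trans ih
  -- abbreviations (pure numbers; opaque, unfolded only by their defining equations)
  obtain ⟨s, hs_def⟩ : ∃ s : ℝ, s = Real.sqrt 2 / 2 := ⟨_, rfl⟩
  obtain ⟨σ, hσ_def⟩ : ∃ σ : ℝ, σ = Real.sqrt 2 / (1 + p₀) := ⟨_, rfl⟩
  obtain ⟨D2, hD2_def⟩ : ∃ D2 : ℝ, D2 = 2 * Real.sqrt 2 / (k₂ : ℝ) := ⟨_, rfl⟩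
  obtain ⟨D3, hD3_def⟩ : ∃ D3 : ℝ, D3 = 2 * Real.sqrt 2 / (k₃ : ℝ) := ⟨_, rfl⟩
  obtain ⟨E, hE_def⟩ : ∃ E : ℝ, E = 2 * ((k₂ : ℝ) + 1) / (k₃ : ℝ) := ⟨_, rfl⟩
  have hs0' : 0 ≤ s := by rw [hs_def]; positivity
  have hs_lt1 : s < 1 := by rw [hs_def]; linarith
  have hc0 : 0 ≤ 1 - s := by linarith
  have hD20 : 0 ≤ D2 := by rw [hD2_def]; positivity
  have hD30 : 0 ≤ D3 := by rw [hD3_def]; positivity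
  have hE0 : 0 ≤ E := by rw [hE_def]; positivity
  have hE1 : E ≤ 1 := by rw [hE_def, div_le_one hkr]; exact hk23r
  have hD32 : D3 ≤ D2 := by
    rw [hD3_def, hD2_def]; exact div_le_div_of_nonneg_left (by positivity) hjr (by linarith)
  have hσ2 : σ ≤ 2 * s := by
    rw [hσ_def, hs_def]; have := div_le_self hs0 (show (1 : ℝ) ≤ 1 + p₀ by linarith); linarith
  -- the displayed inequality, unpacked: 2∕k₂ = D2·s, (σ−s)·2√2∕k₃ = (σ−s)D3, (σ−s)(√2−1)(k₂+1)∕k₃ = (σ−s)(1−s)s·E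
  have hv3 : 0 ≤ (1 - s) - ((1 - s) + D2) * s - ((1 - s) + D3) * (σ - s) + ((1 - s) - (1 - s) * E) * s * (σ - s) := by
    have e1 : (1 - s) - ((1 - s) + D2) * s - ((1 - s) + D3) * (σ - s) + ((1 - s) - (1 - s) * E) * s * (σ - s)
        = (1 - s) ^ 2 * (1 + s - σ) - (2 / (k₂ : ℝ) + (σ - s) * (2 * Real.sqrt 2 + (Real.sqrt 2 - 1) * ((k₂ : ℝ) + 1)) / k₃) := by
      rw [hD2_def, hD3_def, hE_def, hs_def]
      linear_combination (-1 / (k₂ : ℝ) + (σ - Real.sqrt 2 / 2) * ((k₂ : ℝ) + 1) / (2 * (k₃ : ℝ))) * hs2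
    rw [e1]
    have : 2 / (k₂ : ℝ) + (σ - s) * (2 * Real.sqrt 2 + (Real.sqrt 2 - 1) * ((k₂ : ℝ) + 1)) / k₃ ≤ (1 - s) ^ 2 * (1 + s - σ) := by
      simpa [hs_def, hσ_def] using hv
    linarith
  -- the data of (E92d) `pentagon_bilinear_nonneg` with x = x₂, y = x₃: G₀ = 1−s, G₁ = (1−s)+D2, G₂ = (1−s)+D3, G₁₂ = (1−s)(1−E)
  have hG12 : 0 ≤ (1 - s) - (1 - s) * E := by have := mul_le_mul_of_nonneg_left hE1 hc0; linarith
  have hslope : ((1 - s) - (1 - s) * E) * s ≤ (1 - s) + D3 := by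
    linarith [mul_nonneg (mul_nonneg hc0 hE0) hs0', mul_nonneg hc0 hc0]
  have hv4 : 0 ≤ (1 - s) - ((1 - s) + D2) * (σ - s) - ((1 - s) + D3) * s + ((1 - s) - (1 - s) * E) * (σ - s) * s := by
    have : 0 ≤ (D2 - D3) * (2 * s - σ) := mul_nonneg (by linarith) (by linarith)
    linarith [hv3, this]
  have hv2 : 0 ≤ (1 - s) - ((1 - s) + D3) * s := by
    -- D3·s ≤ D2·s = 2∕k₂ ≤ (1−s)²(1+s−σ) ≤ (1−s)²  (from the displayed inequality)
    have hQ : 2 / (k₂ : ℝ) + (σ - s) * (2 * Real.sqrt 2 + (Real.sqrt 2 - 1) * ((k₂ : ℝ) + 1)) / k₃ ≤ (1 - s) ^ 2 * (1 + s - σ) := by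
      simpa [hs_def, hσ_def] using hv
    have hp1 : p₀ ≤ 1 := by
      by_contra hgt
      have h4 : 1 < p₀ ^ 4 := one_lt_pow₀ (not_le.mp hgt) (by norm_num)
      have := mul_le_mul_of_nonneg_right h4.le (show (0 : ℝ) ≤ (k₃ : ℝ) + 1 by positivity)
      linarith
    have hσs : 0 ≤ σ - s := by
      rw [hσ_def, hs_def]
      have := div_le_div_of_nonneg_left hs0 h1p (show 1 + p₀ ≤ 2 by linarith)
      linarith
    have hT0 : 0 ≤ (σ - s) * (2 * Real.sqrt 2 + (Real.sqrt 2 - 1) * ((k₂ : ℝ) + 1)) / k₃ := by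
      have : 0 ≤ 2 * Real.sqrt 2 + (Real.sqrt 2 - 1) * ((k₂ : ℝ) + 1) := by
        have := mul_nonneg (show (0 : ℝ) ≤ Real.sqrt 2 - 1 by linarith) (show (0 : ℝ) ≤ (k₂ : ℝ) + 1 by positivity)
        linarith
      positivity
    have e2 : D2 * s = 2 / (k₂ : ℝ) := by
      rw [hD2_def, hs_def, div_mul_div_comm, div_eq_div_iff (by positivity) (by positivity)]
      linear_combination (2 * (k₂ : ℝ)) * hs2
    have hw1 : (1 - s) ^ 2 * (1 + s - σ) ≤ (1 - s) ^ 2 := by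
      have := mul_le_mul_of_nonneg_left (show 1 + s - σ ≤ 1 by linarith) (sq_nonneg (1 - s))
      linarith
    linarith [mul_le_mul_of_nonneg_right hD32 hs0', e2, hQ, hT0, hw1]
  -- the aggregate row is the young row plus the middle row plus the old row
  have hKA1 : ∀ m l, KA 1 m l = KL 1 m l + (KL k₂ m l + KL k₃ m l) := by
    intro m l
    have h1 : KA 1 m l = ∑ k' ∈ Ico 1 (K - 1 + 1), KL k' m l :=
      aggregate_eq_sum (n := K - 1) hKA (fun m l => by rw [Nat.sub_add_cancel hK]; exact hKAtop m l) (show 1 ≤ K - 1 + 1 by omega) m l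
    rw [h1, Nat.sub_add_cancel hK]
    have hsub : ({1, k₂, k₃} : Finset ℕ) ⊆ Ico 1 K := by
      intro x hx
      simp only [mem_insert, mem_singleton] at hx
      rw [mem_Ico]; rcases hx with rfl | rfl | rfl <;> omega
    rw [← sum_subset hsub (fun x hx hxn => by
      simp only [mem_insert, mem_singleton, not_or] at hxn
      rw [hKL]
      split_ifs
      · rw [hL3 x (mem_Ico.mp hx).2 hxn.1 hxn.2.1 hxn.2.2]; simp
      · rfl), sum_insert (by simp only [mem_insert, mem_singleton]; omega), sum_pair (by omega)]
  have hrec3 : ∀ p, ε p = e p - ∑ l ∈ range K, KL 1 p l * ε (p + 1 + l)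
      - (∑ l ∈ range K, KL k₂ p l * ε (p + 1 + l) + ∑ l ∈ range K, KL k₃ p l * ε (p + 1 + l)) := by
    intro p
    rw [hεrec p, hRA]
    have : ∑ l ∈ range K, KA 1 p l * ε (p + 1 + l) = ∑ l ∈ range K, KL 1 p l * ε (p + 1 + l)
        + (∑ l ∈ range K, KL k₂ p l * ε (p + 1 + l) + ∑ l ∈ range K, KL k₃ p l * ε (p + 1 + l)) := by
      rw [← sum_add_distrib, ← sum_add_distrib]; exact sum_congr rfl fun l _ => by rw [hKA1]; ring
    rw [this]; ring
  refine renewal_bounds_of_step he0 hεt fun m IH => ?_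
  have hread0 : ∀ a p, m ≤ p → 0 ≤ ∑ l ∈ range K, KL a p l * ε (p + 1 + l) := fun a p hp =>
    sum_nonneg fun l _ => mul_nonneg (kernel_entry_le hL hh hg hKL a p l).1 (IH _ (by omega)).1
  have hreadle : ∀ {a : ℕ}, a < K → ∑ l ∈ range K, KL a m l * ε (m + 1 + l) ≤ (a : ℝ) * (L a * h (m + a) ^ 3 / 2) * e m := by
    intro a haK
    calc ∑ l ∈ range K, KL a m l * ε (m + 1 + l) ≤ ∑ l ∈ range K, KL a m l * e m :=
          sum_le_sum fun l _ => mul_le_mul_of_nonneg_left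
            (((IH _ (by omega)).2).trans (hea' m (m + 1 + l) (by omega))) (kernel_entry_le hL hh hg hKL a m l).1
      _ = (∑ l ∈ range K, KL a m l) * e m := by rw [sum_mul]
      _ ≤ (a : ℝ) * (L a * h (m + a) ^ 3 / 2) * e m := mul_le_mul_of_nonneg_right (row_mass_le hL hh hg hKL haK m) (he0 m)
  -- the three loads at the pin and the old-pair share bound
  have hx1' := window_load_le_sqrt_two_div_two hmono hL hb hlo hdom hh hf h1K m
  have hx2 := window_load_le_sqrt_two_div_two hmono hL hb hlo hdom hh hf hk2K m
  have hx3 := window_load_le_sqrt_two_div_two hmono hL hb hlo hdom hh hf hk3K m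
  have hpair' := pair_load_le_of_ratio hmono hL hb hlo hdom hh hf (show 1 ≤ k₂ by omega) (show k₂ < k₃ by omega) hk3K hp0 hp m
  set c1 := L 1 * h (m + 1) ^ 3 / 2 with hc1_def
  set c2 := L k₂ * h (m + k₂) ^ 3 / 2 with hc2_def
  set c3 := L k₃ * h (m + k₃) ^ 3 / 2 with hc3_def
  have hc10 : 0 ≤ c1 := by have := hL 1; have := hpos (m + 1); positivity
  have hc20 : 0 ≤ c2 := by have := hL k₂; have := hpos (m + k₂); positivity
  have hc30 : 0 ≤ c3 := by have := hL k₃; have := hpos (m + k₃); positivity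
  have hx1 : c1 ≤ s := by rw [hs_def]; simpa using hx1'
  have hpair : (k₂ : ℝ) * c2 + (k₃ : ℝ) * c3 ≤ σ := by rw [hσ_def]; exact hpair'
  have hx2s : (k₂ : ℝ) * c2 ≤ s := by rw [hs_def]; exact hx2
  have hx3s : (k₃ : ℝ) * c3 ≤ s := by rw [hs_def]; exact hx3
  have hem := he0 m
  -- h(x₂, x₃) ≥ 0 at the actual loads, and hence R₂ ≥ 0
  have hh0 := pentagon_bilinear_nonneg (s := s) (σ := σ) (G₀ := 1 - s) (G₁ := (1 - s) + D2) (G₂ := (1 - s) + D3) (G₁₂ := (1 - s) - (1 - s) * E)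
    (x := (k₂ : ℝ) * c2) (y := (k₃ : ℝ) * c3) (mul_nonneg (Nat.cast_nonneg _) hc20) hx2s hx3s hpair hG12 hslope hv2 hv3 hv4
  -- unit conversions between loads and lag-zero coefficients
  have e1 : D2 * ((k₂ : ℝ) * c2) = 4 * s * c2 := by
    rw [hD2_def, hs_def, div_mul_eq_mul_div, div_eq_iff hk2ne]; ring
  have e2 : D3 * ((k₃ : ℝ) * c3) = 4 * s * c3 := by
    rw [hD3_def, hs_def, div_mul_eq_mul_div, div_eq_iff hk3ne]; ring
  have e3 : E * ((k₂ : ℝ) * c2) * ((k₃ : ℝ) * c3) = 2 * ((k₂ : ℝ) * c2) * ((k₂ : ℝ) + 1) * c3 := by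
    rw [hE_def, div_mul_eq_mul_div, div_mul_eq_mul_div, div_eq_iff hk3ne]; ring
  have hR2nn : 0 ≤ (1 - (k₂ : ℝ) * c2) * (1 - (k₃ : ℝ) * c3) - 2 * ((k₂ : ℝ) * c2) * ((k₂ : ℝ) + 1) * c3 := by
    -- (1−s)·R₂ ≥ h ≥ 0
    have hD : 0 ≤ D2 * ((k₂ : ℝ) * c2) + D3 * ((k₃ : ℝ) * c3) := by positivity
    have hc0' : 0 < 1 - s := by linarith
    have key : (1 - s) * ((1 - (k₂ : ℝ) * c2) * (1 - (k₃ : ℝ) * c3) - 2 * ((k₂ : ℝ) * c2) * ((k₂ : ℝ) + 1) * c3)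
        = ((1 - s) - ((1 - s) + D2) * ((k₂ : ℝ) * c2) - ((1 - s) + D3) * ((k₃ : ℝ) * c3)
          + ((1 - s) - (1 - s) * E) * ((k₂ : ℝ) * c2) * ((k₃ : ℝ) * c3)) + (D2 * ((k₂ : ℝ) * c2) + D3 * ((k₃ : ℝ) * c3)) := by
      linear_combination (1 - s) * e3
    exact (mul_nonneg_iff_of_pos_left hc0').mp (by rw [key]; linarith)
  -- STEP 1 (old residual): e − O ≥ (1 − x₃)e ≥ 0
  have hOle : ∑ l ∈ range K, KL k₃ m l * ε (m + 1 + l) ≤ (k₃ : ℝ) * c3 * e m := hreadle hk3K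
  have hres1 : (1 - (k₃ : ℝ) * c3) * e m ≤ e m - ∑ l ∈ range K, KL k₃ m l * ε (m + 1 + l) := by linarith only [hOle]
  have hx3le1 : 0 ≤ 1 - (k₃ : ℝ) * c3 := by linarith
  have hres1' : 0 ≤ e m - ∑ l ∈ range K, KL k₃ m l * ε (m + 1 + l) := le_trans (mul_nonneg hx3le1 hem) hres1
  -- STEP 2 (middle against old, actual loads): sy = x₂, first moment c₂k₂(k₂+1)∕2, variation 4c₃ per lag
  have hW2 : ∑ l ∈ range K, KL k₂ m l ≤ (k₂ : ℝ) * c2 := row_mass_le hL hh hg hKL hk2K m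
  have hstep2 := residual_step_moment (i := k₂) (Kw := K) (m := m) (sy := (k₂ : ℝ) * c2) (V := 4 * c3)
    (M₁ := c2 * ((k₂ : ℝ) * ((k₂ : ℝ) + 1) / 2))
    (wy := fun l => KL k₂ m l) (O := fun p => ∑ l ∈ range K, KL k₃ p l * ε (p + 1 + l)) (e := e) (ε := ε)
    (fun l => (kernel_entry_le hL hh hg hKL k₂ m l).1) (fun l hl => by rw [hKL, if_neg (by omega)])
    hW2 (row_moment_le hL hh hg hKL hk2K m) (by positivity) he0 hea
    (fun q hq => by
      have := hrec3 q
      have h1 := hread0 1 q hq.le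
      have h2 := hread0 k₂ q hq.le
      linarith only [this, h1, h2])
    hres1'
    (fun d hd1 hdj => by
      have hdk : d ≤ k₃ := by omega
      have hv' := old_read_variation hmono hL hb hlo hdom hh hf hL0 hg hgF hKL hk hk3K hd1 hdk he0 hea IH
      rw [← hc3_def] at hv'
      linarith only [hv'])
  -- the middle residual with the actual loads: e − O − M ≥ R₂·e ≥ 0
  have hR2 : ((1 - (k₂ : ℝ) * c2) * (1 - (k₃ : ℝ) * c3) - 2 * ((k₂ : ℝ) * c2) * ((k₂ : ℝ) + 1) * c3) * e m
      ≤ e m - (∑ l ∈ range K, KL k₂ m l * ε (m + 1 + l) + ∑ l ∈ range K, KL k₃ m l * ε (m + 1 + l)) := by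
    have hx2le1 : 0 ≤ 1 - (k₂ : ℝ) * c2 := by linarith
    have h1 := mul_le_mul_of_nonneg_left hres1 hx2le1
    have e4 : c2 * ((k₂ : ℝ) * ((k₂ : ℝ) + 1) / 2) * (4 * c3) * e m = 2 * ((k₂ : ℝ) * c2) * ((k₂ : ℝ) + 1) * c3 * e m := by ring
    linarith only [hstep2, h1, e4]
  have hres2' : 0 ≤ e m - (∑ l ∈ range K, KL k₂ m l * ε (m + 1 + l) + ∑ l ∈ range K, KL k₃ m l * ε (m + 1 + l)) :=
    le_trans (mul_nonneg hR2nn hem) hR2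
  -- STEP 3 (young against both): sy = s ≥ x₁, first moment c₁, variation 4(c₂ + c₃) per lag
  have hW1 : ∑ l ∈ range K, KL 1 m l ≤ s :=
    ((row_mass_le hL hh hg hKL h1K m).trans (le_of_eq (by rw [hc1_def]; simp))).trans hx1
  have hM1 : ∑ l ∈ range K, KL 1 m l * ((l : ℝ) + 1) ≤ c1 :=
    (row_moment_le hL hh hg hKL h1K m).trans (le_of_eq (by rw [hc1_def]; norm_num))
  have hstep3 := residual_step_moment (i := 1) (Kw := K) (m := m) (sy := s) (V := 4 * (c2 + c3)) (M₁ := c1)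
    (wy := fun l => KL 1 m l)
    (O := fun p => ∑ l ∈ range K, KL k₂ p l * ε (p + 1 + l) + ∑ l ∈ range K, KL k₃ p l * ε (p + 1 + l)) (e := e) (ε := ε)
    (fun l => (kernel_entry_le hL hh hg hKL 1 m l).1) (fun l hl => by rw [hKL, if_neg (by omega)])
    hW1 hM1 (by positivity) he0 hea
    (fun q hq => by
      have := hrec3 q
      have h1 := hread0 1 q hq.le
      linarith only [this, h1])
    hres2'
    (fun d hd1 hdi => by
      have hdj : d ≤ k₂ := by omega
      have hdk : d ≤ k₃ := by omega
      have hvj := old_read_variation hmono hL hb hlo hdom hh hf hL0 hg hgF hKL hj hk2K hd1 hdj he0 hea IH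
      have hvk := old_read_variation hmono hL hb hlo hdom hh hf hL0 hg hgF hKL hk hk3K hd1 hdk he0 hea IH
      rw [← hc2_def] at hvj
      rw [← hc3_def] at hvk
      linarith only [hvj, hvk])
  -- assemble: ε ≥ (1−s)·R₂·e − 4c₁(c₂+c₃)e ≥ (1−s)R₂e − 4s(c₂+c₃)e = h(x₂,x₃)·e ≥ 0
  have hεm : ε m = e m - ∑ l ∈ range K, KL 1 m l * ε (m + 1 + l)
      - (∑ l ∈ range K, KL k₂ m l * ε (m + 1 + l) + ∑ l ∈ range K, KL k₃ m l * ε (m + 1 + l)) := hrec3 m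
  refine ⟨?_, ?_⟩
  · have h1 := mul_le_mul_of_nonneg_left hR2 hc0
    have h3 : c1 * (4 * (c2 + c3)) * e m ≤ s * (4 * (c2 + c3)) * e m :=
      mul_le_mul_of_nonneg_right (mul_le_mul_of_nonneg_right hx1 (by positivity)) hem
    have e1m : ((1 - s) + D2) * ((k₂ : ℝ) * c2) * e m = (1 - s) * ((k₂ : ℝ) * c2) * e m + 4 * s * c2 * e m := by
      linear_combination (e m) * e1
    have e2m : ((1 - s) + D3) * ((k₃ : ℝ) * c3) * e m = (1 - s) * ((k₃ : ℝ) * c3) * e m + 4 * s * c3 * e m := by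
      linear_combination (e m) * e2
    have e3m : ((1 - s) - (1 - s) * E) * ((k₂ : ℝ) * c2) * ((k₃ : ℝ) * c3) * e m
        = (1 - s) * (((k₂ : ℝ) * c2) * ((k₃ : ℝ) * c3)) * e m - (1 - s) * (2 * ((k₂ : ℝ) * c2) * ((k₂ : ℝ) + 1) * c3) * e m := by
      linear_combination (-(1 - s) * e m) * e3
    have hge : ((1 - s) - ((1 - s) + D2) * ((k₂ : ℝ) * c2) - ((1 - s) + D3) * ((k₃ : ℝ) * c3)
          + ((1 - s) - (1 - s) * E) * ((k₂ : ℝ) * c2) * ((k₃ : ℝ) * c3)) * e m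
        ≤ e m - ∑ l ∈ range K, KL 1 m l * ε (m + 1 + l)
          - (∑ l ∈ range K, KL k₂ m l * ε (m + 1 + l) + ∑ l ∈ range K, KL k₃ m l * ε (m + 1 + l)) := by
      linarith only [hstep3, h1, h3, e1m, e2m, e3m]
    rw [hεm]
    exact le_trans (mul_nonneg hh0 hem) hge
  · rw [hεm]
    linarith only [hread0 1 m le_rfl, hread0 k₂ m le_rfl, hread0 k₃ m le_rfl]

/-! ## §2 The displayed inequality from rational data -/

/-- The old-pair slack `σ − √2∕2 = √2(1−p₀)∕(2(1+p₀))` is in `[0, u_U]` as soon as `0 ≤ p₀ ≤ 1` and `(99∕70)(1−p₀) ≤ 2u_U(1+p₀)`. [folklore] -/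
theorem old_pair_slack_le {p₀ uU : ℝ} (hp0 : 0 ≤ p₀) (hp1 : p₀ ≤ 1) (hcheck : (99 / 70) * (1 - p₀) ≤ 2 * uU * (1 + p₀)) :
    0 ≤ Real.sqrt 2 / (1 + p₀) - Real.sqrt 2 / 2 ∧ Real.sqrt 2 / (1 + p₀) - Real.sqrt 2 / 2 ≤ uU := by
  have hs99 : Real.sqrt 2 ≤ 99 / 70 := Real.sqrt_le_iff.mpr ⟨by norm_num, by norm_num⟩
  have hs0 : 0 ≤ Real.sqrt 2 := Real.sqrt_nonneg 2
  have h1p : 0 < 1 + p₀ := by linarith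
  have e1 : Real.sqrt 2 / (1 + p₀) - Real.sqrt 2 / 2 = Real.sqrt 2 * (1 - p₀) / (2 * (1 + p₀)) := by field_simp; ring
  rw [e1]
  refine ⟨by positivity, ?_⟩
  rw [div_le_iff₀ (by positivity)]
  nlinarith [mul_le_mul_of_nonneg_right hs99 (show (0 : ℝ) ≤ 1 - p₀ by linarith)]

/-- The displayed inequality of §1 from rational data on a band: if `0 ≤ σ − √2∕2 ≤ u_U < 1`, `K_lo ≤ k₂`, `r_lo(k₂+1) ≤ k₃` (`K_lo, r_lo > 0`) and
`2∕K_lo + u_U·((99∕35)∕(r_lo(K_lo+1)) + (29∕70)∕r_lo) ≤ (41∕140)²·(1 − u_U)` (`√2 ∈ [1, 99∕70]`), then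
`2∕k₂ + (σ − √2∕2)(2√2 + (√2−1)(k₂+1))∕k₃ ≤ (1 − √2∕2)²(1 + √2∕2 − σ)`. [folklore] -/
theorem old_pair_check {σ uU Klo rlo k₂ k₃ : ℝ} (hu0 : 0 ≤ σ - Real.sqrt 2 / 2) (hu : σ - Real.sqrt 2 / 2 ≤ uU) (huU : uU ≤ 1)
    (hKlo : 0 < Klo) (hrlo : 0 < rlo) (hk2 : Klo ≤ k₂) (hk3 : rlo * (k₂ + 1) ≤ k₃)
    (hcheck : 2 / Klo + uU * ((99 / 35) / (rlo * (Klo + 1)) + (29 / 70) / rlo) ≤ (41 / 140) ^ 2 * (1 - uU)) :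
    2 / k₂ + (σ - Real.sqrt 2 / 2) * (2 * Real.sqrt 2 + (Real.sqrt 2 - 1) * (k₂ + 1)) / k₃
      ≤ (1 - Real.sqrt 2 / 2) ^ 2 * (1 + Real.sqrt 2 / 2 - σ) := by
  have hs99 : Real.sqrt 2 ≤ 99 / 70 := Real.sqrt_le_iff.mpr ⟨by norm_num, by norm_num⟩
  have hs1 : (1 : ℝ) ≤ Real.sqrt 2 := by rw [Real.le_sqrt (by norm_num) (by norm_num)]; norm_num
  have hk2p : 0 < k₂ := lt_of_lt_of_le hKlo hk2
  have hk21 : 0 < k₂ + 1 := by linarith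
  have hk3p : 0 < k₃ := lt_of_lt_of_le (by positivity) hk3
  set u := σ - Real.sqrt 2 / 2 with hu_def
  -- term by term
  have h1 : 2 / k₂ ≤ 2 / Klo := div_le_div_of_nonneg_left (by norm_num) hKlo hk2
  have h2 : (k₂ + 1) / k₃ ≤ 1 / rlo := by
    rw [div_le_div_iff₀ hk3p hrlo]; linarith
  have h3 : 1 / k₃ ≤ 1 / (rlo * (Klo + 1)) := by
    apply one_div_le_one_div_of_le (by positivity)
    calc rlo * (Klo + 1) ≤ rlo * (k₂ + 1) := mul_le_mul_of_nonneg_left (by linarith) hrlo.le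
      _ ≤ k₃ := hk3
  have hA : 2 * Real.sqrt 2 ≤ 99 / 35 := by linarith
  have hB : Real.sqrt 2 - 1 ≤ 29 / 70 := by linarith
  have h4 : u * (2 * Real.sqrt 2 + (Real.sqrt 2 - 1) * (k₂ + 1)) / k₃ ≤ uU * ((99 / 35) / (rlo * (Klo + 1)) + (29 / 70) / rlo) := by
    have step1 : u * (2 * Real.sqrt 2 + (Real.sqrt 2 - 1) * (k₂ + 1)) / k₃
        = u * ((2 * Real.sqrt 2) * (1 / k₃) + (Real.sqrt 2 - 1) * ((k₂ + 1) / k₃)) := by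
      ring
    rw [step1]
    have hin : (2 * Real.sqrt 2) * (1 / k₃) + (Real.sqrt 2 - 1) * ((k₂ + 1) / k₃) ≤ (99 / 35) / (rlo * (Klo + 1)) + (29 / 70) / rlo := by
      have t1 : (2 * Real.sqrt 2) * (1 / k₃) ≤ (99 / 35) * (1 / (rlo * (Klo + 1))) :=
        mul_le_mul hA h3 (by positivity) (by norm_num)
      have t2 : (Real.sqrt 2 - 1) * ((k₂ + 1) / k₃) ≤ (29 / 70) * (1 / rlo) :=
        mul_le_mul hB h2 (by positivity) (by norm_num)
      have e1 : (99 / 35 : ℝ) * (1 / (rlo * (Klo + 1))) = (99 / 35) / (rlo * (Klo + 1)) := by ring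
      have e2 : (29 / 70 : ℝ) * (1 / rlo) = (29 / 70) / rlo := by ring
      linarith
    have hin0 : 0 ≤ (2 * Real.sqrt 2) * (1 / k₃) + (Real.sqrt 2 - 1) * ((k₂ + 1) / k₃) :=
      add_nonneg (mul_nonneg (by positivity) (one_div_nonneg.2 hk3p.le))
        (mul_nonneg (by linarith) (div_nonneg hk21.le hk3p.le))
    exact mul_le_mul hu hin hin0 (hu0.trans hu)
  have h5 : ((41 : ℝ) / 140) ^ 2 * (1 - uU) ≤ (1 - Real.sqrt 2 / 2) ^ 2 * (1 + Real.sqrt 2 / 2 - σ) := by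
    have hsq : ((41 : ℝ) / 140) ^ 2 ≤ (1 - Real.sqrt 2 / 2) ^ 2 := pow_le_pow_left₀ (by norm_num) (by linarith) 2
    have hw : 1 - uU ≤ 1 + Real.sqrt 2 / 2 - σ := by linarith
    exact mul_le_mul hsq hw (by linarith) (sq_nonneg _)
  linarith

end Summit.QuantumFields.BalabanUV.Beta.EriceRemainderEnclosureHistoryAutonomyComparisonAgeCompositionNestedOldPair

end
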